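import Literature.Analysis.SpecialFunctions.KummerM
import Literature.Analysis.SpecialFunctions.HypergeometricEulerTransformation
import Mathlib.Analysis.SpecialFunctions.Exponential
import HarnessLib

/-!
# Kummer's first transformation `M(a, b, z) = e^z M(b − a, b, −z)`

For Kummer's entire function `M(a, b, z) = ₁F₁(a; b; z)` of `KummerM.lean` (`kummerM`) and
`b ∉ −ℕ₀` we prove **Kummer's transformation, DLMF 13.2.39**:

  `kummerM a b z = exp z * kummerM (b − a) b (−z)`      (`kummerM_kummer`),

by the Cauchy product of the two everywhere absolutely convergent series
`M(b−a, b, −z) = Σₖ αₖ(b−a,b) (−z)ᵏ` and `e^z = Σₘ zᵐ/m!`: the coefficient of `zⁿ` is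
`Σₖ (−1)ᵏ αₖ(b−a,b)/(n−k)!`, and this equals `αₙ(a,b)` (`sum_neg_pow_mul_coeff_div_factorial`).
Cleared of the denominators `n!(b)ₙ` that is the polynomial identity

  `Σₖ C(n,k) (−1)ᵏ (β)ₖ (γ+k)ₙ₋ₖ = (γ−β)ₙ`      (`sum_choose_mul_neg_pow_mul_ascPochhammer`),

i.e. the Chu–Vandermonde evaluation `₂F₁(−n, β; γ; 1) = (γ−β)ₙ/(γ)ₙ` (DLMF 15.4.24), which we
derive from the binomial theorem for rising factorials
`(x+y)ₙ = Σₖ C(n,k) (x)ₖ (y)ₙ₋ₖ` (`ascPochhammer_eval_add_sum`, induction with Pascal's rule as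
in Mathlib's `descPochhammer_smeval_add`) and the reflection `(x)ₘ = (−1)ᵐ (1−x−m)ₘ`
(`ascPochhammer_eval_reflect`); `(b)ₙ = (b)ₖ(b+k)ₙ₋ₖ` and `(b)ₖ ≠ 0` are this seat's
`Hypergeometric.ascPochhammer_eval_split` / `…_ne_zero_of_ne_neg_nat`. Corollaries:
`exp_neg_mul_kummerM` (the same identity read as `e^{−z} M(a,b,z) = M(b−a,b,−z)`),
`kummerM_zero_left : M(0, b, z) = 1` and `kummerM_self : M(b, b, z) = e^z` (DLMF 13.6.1) for
`b ∉ −ℕ₀`.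

Why `b ∉ −ℕ₀`: for `b = −m` Mathlib-style junk makes `kummerM a (−m)` a polynomial, for which
the transformation is false in general.

References: NIST DLMF (13.2.39), (13.6.1), (15.4.24) [DLMF]; G. E. Andrews, R. Askey, R. Roy,
*Special Functions* (1999), (4.1.11), Cor. 2.2.3 [AndrewsAskeyRoy1999].
-/

noncomputable section

open Finset
open scoped Nat

namespace Literature.Analysis.SpecialFunctions.Confluent

/-! ### Rising-factorial algebra: Vandermonde, reflection, Chu–Vandermonde -/

section Pochhammer

/-- **The binomial theorem for rising factorials** (Vandermonde's convolution):
`(x+y)ₙ = Σₖ C(n,k) (x)ₖ (y)ₙ₋ₖ`, antidiagonal form. [cite: AndrewsAskeyRoy1999, Cor. 2.2.3] -/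
theorem ascPochhammer_eval_add_antidiagonal (x y : ℂ) (n : ℕ) :
    (ascPochhammer ℂ n).eval (x + y) =
      ∑ ij ∈ antidiagonal n, (n.choose ij.1 : ℂ) *
        ((ascPochhammer ℂ ij.1).eval x * (ascPochhammer ℂ ij.2).eval y) := by
  induction n with
  | zero => simp
  | succ k ih =>
    rw [ascPochhammer_succ_eval, ih, Finset.sum_mul, Finset.sum_antidiagonal_choose_succ_mul
      (fun i j => (ascPochhammer ℂ i).eval x * (ascPochhammer ℂ j).eval y),
      ← Finset.sum_add_distrib]
    refine Finset.sum_congr rfl fun ij hij => ?_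
    have hk : ij.1 + ij.2 = k := mem_antidiagonal.1 hij
    rw [← Nat.choose_symm_of_eq_add hk.symm]
    simp only [ascPochhammer_succ_eval]
    have hk' : (k : ℂ) = ij.1 + ij.2 := by exact_mod_cast hk.symm
    rw [hk']
    ring

/-- **The binomial theorem for rising factorials**, `range` form:
`(x+y)ₙ = Σₖ₌₀ⁿ C(n,k) (x)ₖ (y)ₙ₋ₖ`. [cite: AndrewsAskeyRoy1999, Cor. 2.2.3] -/
theorem ascPochhammer_eval_add_sum (x y : ℂ) (n : ℕ) :
    (ascPochhammer ℂ n).eval (x + y) =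
      ∑ k ∈ range (n + 1), (n.choose k : ℂ) *
        ((ascPochhammer ℂ k).eval x * (ascPochhammer ℂ (n - k)).eval y) := by
  rw [ascPochhammer_eval_add_antidiagonal, ← Nat.sum_antidiagonal_eq_sum_range_succ
    (fun i j => (n.choose i : ℂ) * ((ascPochhammer ℂ i).eval x * (ascPochhammer ℂ j).eval y))]

/-- **Reflection of rising factorials**: `(x)ₘ = (−1)ᵐ (1 − x − m)ₘ`. [cite: DLMF, 5.2.6] -/
theorem ascPochhammer_eval_reflect (x : ℂ) (m : ℕ) :
    (ascPochhammer ℂ m).eval x = (-1) ^ m * (ascPochhammer ℂ m).eval (1 - x - m) := by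
  have h := ascPochhammer_eval_neg_eq_descPochhammer ℂ (-x) m
  rw [neg_neg, descPochhammer_eval_eq_ascPochhammer] at h
  rw [h, show (-x - m + 1 : ℂ) = 1 - x - m by ring]

/-- **Chu–Vandermonde in rising-factorial form**:
`Σₖ₌₀ⁿ C(n,k) (−1)ᵏ (β)ₖ (γ+k)ₙ₋ₖ = (γ−β)ₙ` — the terminating evaluation
`₂F₁(−n, β; γ; 1) = (γ−β)ₙ/(γ)ₙ` multiplied by `(γ)ₙ` (a polynomial identity, no hypothesis).
[cite: DLMF, 15.4.24] -/
theorem sum_choose_mul_neg_pow_mul_ascPochhammer (β γ : ℂ) (n : ℕ) :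
    ∑ k ∈ range (n + 1), (n.choose k : ℂ) * (-1) ^ k * (ascPochhammer ℂ k).eval β *
        (ascPochhammer ℂ (n - k)).eval (γ + k) =
      (ascPochhammer ℂ n).eval (γ - β) := by
  -- reflect `(γ+k)ₙ₋ₖ = (−1)ⁿ⁻ᵏ (1−γ−n)ₙ₋ₖ`; the sum becomes `(−1)ⁿ (β + 1 − γ − n)ₙ = (γ−β)ₙ`
  have hV := ascPochhammer_eval_add_sum β (1 - γ - n) n
  have hR := ascPochhammer_eval_reflect (β + (1 - γ - n)) n
  rw [show (1 - (β + (1 - γ - ↑n)) - ↑n : ℂ) = γ - β by ring] at hR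
  have hnn : ((-1 : ℂ) ^ n) * (-1) ^ n = 1 := by rw [← pow_add, ← two_mul, pow_mul]; simp
  calc _ = (-1 : ℂ) ^ n * ∑ k ∈ range (n + 1), (n.choose k : ℂ) *
        ((ascPochhammer ℂ k).eval β * (ascPochhammer ℂ (n - k)).eval (1 - γ - n)) := by
        rw [Finset.mul_sum]
        refine Finset.sum_congr rfl fun k hk => ?_
        have hkn : k ≤ n := Nat.lt_succ_iff.1 (mem_range.1 hk)
        rw [ascPochhammer_eval_reflect (γ + k) (n - k), Nat.cast_sub hkn,
          show (1 - (γ + k) - (n - k) : ℂ) = 1 - γ - n by ring]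
        have hsign : ((-1 : ℂ) ^ k) * (-1) ^ (n - k) = (-1) ^ n := by
          rw [← pow_add, Nat.add_sub_cancel' hkn]
        linear_combination ((n.choose k : ℂ) * (ascPochhammer ℂ k).eval β *
          (ascPochhammer ℂ (n - k)).eval (1 - γ - n)) * hsign
    _ = _ := by
        rw [← hV]
        linear_combination (-1 : ℂ) ^ n * hR + ((ascPochhammer ℂ n).eval (γ - β)) * hnn

end Pochhammer

/-! ### The coefficient identity and Kummer's transformation -/

section Kummer

variable {a b : ℂ}

/-- **The coefficient of `zⁿ` in `e^z M(b−a, b, −z)` is `αₙ(a, b)`** (`b ∉ −ℕ₀`):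
`Σₖ₌₀ⁿ (−1)ᵏ αₖ(b−a,b) / (n−k)! = αₙ(a,b)` — Chu–Vandermonde divided by `n!(b)ₙ`.
[cite: DLMF, 13.2.39] -/
theorem sum_neg_pow_mul_coeff_div_factorial (hb : ∀ n : ℕ, b ≠ -n) (n : ℕ) :
    ∑ k ∈ range (n + 1), (-1) ^ k * kummerMCoefficient (b - a) b k * (((n - k)! : ℕ) : ℂ)⁻¹ =
      kummerMCoefficient a b n := by
  have hPn : (ascPochhammer ℂ n).eval b ≠ 0 :=
    Hypergeometric.ascPochhammer_eval_ne_zero_of_ne_neg_nat hb n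
  have hn : ((n ! : ℕ) : ℂ) ≠ 0 := by exact_mod_cast Nat.factorial_ne_zero n
  have hCV := sum_choose_mul_neg_pow_mul_ascPochhammer (b - a) b n
  rw [sub_sub_cancel] at hCV
  -- termwise: `n!(b)ₙ · ((−1)ᵏ αₖ / (n−k)!)` is the Chu–Vandermonde summand
  have hterm : ∀ k ∈ range (n + 1), ((n ! : ℕ) : ℂ) * (ascPochhammer ℂ n).eval b *
      ((-1) ^ k * kummerMCoefficient (b - a) b k * (((n - k)! : ℕ) : ℂ)⁻¹) =
      (n.choose k : ℂ) * (-1) ^ k * (ascPochhammer ℂ k).eval (b - a) *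
        (ascPochhammer ℂ (n - k)).eval (b + k) := by
    intro k hk
    have hkn : k ≤ n := Nat.lt_succ_iff.1 (mem_range.1 hk)
    have hPk : (ascPochhammer ℂ k).eval b ≠ 0 :=
      Hypergeometric.ascPochhammer_eval_ne_zero_of_ne_neg_nat hb k
    have hk0 : ((k ! : ℕ) : ℂ) ≠ 0 := by exact_mod_cast Nat.factorial_ne_zero k
    have hnk0 : (((n - k) ! : ℕ) : ℂ) ≠ 0 := by exact_mod_cast Nat.factorial_ne_zero (n - k)
    have hfact : ((n ! : ℕ) : ℂ) = (n.choose k : ℂ) * ((k ! : ℕ) : ℂ) * (((n - k) ! : ℕ) : ℂ) := by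
      exact_mod_cast (Nat.choose_mul_factorial_mul_factorial hkn).symm
    rw [kummerMCoefficient, Hypergeometric.ascPochhammer_eval_split b hkn, hfact]
    field_simp
  rw [← mul_right_inj' (mul_ne_zero hn hPn), Finset.mul_sum, Finset.sum_congr rfl hterm, hCV,
    kummerMCoefficient]
  field_simp

/-- **Kummer's (first) transformation, DLMF 13.2.39**: for `b ∉ −ℕ₀` and every `z : ℂ`,
`M(a, b, z) = e^z M(b − a, b, −z)` — Cauchy product of the two absolutely convergent series and
the coefficient identity `sum_neg_pow_mul_coeff_div_factorial`. [cite: DLMF, 13.2.39] -/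
theorem kummerM_kummer (hb : ∀ n : ℕ, b ≠ -n) (z : ℂ) :
    kummerM a b z = Complex.exp z * kummerM (b - a) b (-z) := by
  set f : ℕ → ℂ := fun k => kummerMCoefficient (b - a) b k * (-z) ^ k with hf
  set g : ℕ → ℂ := fun m => z ^ m / m ! with hg
  have hf_sum : HasSum f (kummerM (b - a) b (-z)) := hasSum_coeff_mul_pow (-z)
  have hg_sum : HasSum g (Complex.exp z) := by
    rw [Complex.exp_eq_exp_ℂ]
    exact NormedSpace.expSeries_div_hasSum_exp z
  have hf_norm : Summable fun k => ‖f k‖ := by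
    simpa only [hf, norm_mul, norm_pow, norm_neg] using
      summable_norm_coeff_mul_pow (b - a) b (norm_nonneg z)
  have hg_norm : Summable fun m => ‖g m‖ := NormedSpace.norm_expSeries_div_summable z
  -- the Cauchy product
  have hprod := tsum_mul_tsum_eq_tsum_sum_range_of_summable_norm hf_norm hg_norm
  rw [hf_sum.tsum_eq, hg_sum.tsum_eq] at hprod
  have hdiag : ∀ n : ℕ, ∑ k ∈ range (n + 1), f k * g (n - k) =
      kummerMCoefficient a b n * z ^ n := by
    intro n
    rw [← sum_neg_pow_mul_coeff_div_factorial hb n, Finset.sum_mul]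
    refine Finset.sum_congr rfl fun k hk => ?_
    have hkn : k ≤ n := Nat.lt_succ_iff.1 (mem_range.1 hk)
    simp only [hf, hg]
    rw [show z ^ n = z ^ k * z ^ (n - k) by rw [← pow_add, Nat.add_sub_cancel' hkn], neg_pow]
    ring
  simp only [hdiag] at hprod
  rw [← kummerM_eq_tsum] at hprod
  rw [← hprod, mul_comm]

/-- Kummer's transformation read as `e^{−z} M(a, b, z) = M(b − a, b, −z)` (`b ∉ −ℕ₀`).
[cite: DLMF, 13.2.39] -/
theorem exp_neg_mul_kummerM (hb : ∀ n : ℕ, b ≠ -n) (z : ℂ) :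
    Complex.exp (-z) * kummerM a b z = kummerM (b - a) b (-z) := by
  rw [kummerM_kummer hb z, ← mul_assoc, ← Complex.exp_add, neg_add_cancel, Complex.exp_zero,
    one_mul]

/-- `M(0, b, z) = 1` (the series terminates at once: `(0)ₖ = 0` for `k ≥ 1`).
[cite: DLMF, 13.2.2] -/
theorem kummerM_zero_left (b z : ℂ) : kummerM 0 b z = 1 := by
  have h := hasSum_coeff_mul_pow (a := 0) (b := b) z
  have h1 := hasSum_single (f := fun n : ℕ => kummerMCoefficient 0 b n * z ^ n) 0
    (fun n hn => by simp [kummerMCoefficient, ascPochhammer_ne_zero_eval_zero ℂ hn])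
  exact h.unique (by simpa [kummerMCoefficient] using h1)

/-- **DLMF 13.6.1**: `M(b, b, z) = e^z` for `b ∉ −ℕ₀`. [cite: DLMF, 13.6.1] -/
theorem kummerM_self (hb : ∀ n : ℕ, b ≠ -n) (z : ℂ) : kummerM b b z = Complex.exp z := by
  rw [kummerM_kummer hb z, sub_self, kummerM_zero_left, mul_one]

end Kummer

end Literature.Analysis.SpecialFunctions.Confluent

end
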